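import Summits.CriticalPhenomena.CardyFormulaZ2.Theorems.CardySelfRefinementLagHandOffNoIdleAuxCount
import Literature.Probability.Percolation.QuadCrossingCrossedEventInterior
import Literature.Probability.Percolation.QuadCrossingNullFrontier
import Literature.Probability.RandomPlanarGeometry.CurveClassStopAtMeasurable
import Mathlib.MeasureTheory.Integral.Indicator
import HarnessLib

/-!
# One tournament bit passes to the joint limit: the abstract portmanteau step and the quad
sandwich

Helper file for the registered stubs `stub_quadTransfer_bitPassage` and
`stub_quadTransfer_quadSandwich` of line `hitting-tournament` of crux `LagHandOff`
(stmt-CriticalPhenomena-10268).  They are the abstract halves of step (d) (identification of a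
curve bit with a crossing event) of the method behind `stub_quadTransfer` (R1): a joint
subsequential limit `λ` on `ℋ_ℂ × CurveClass ℂ` of (quad-crossing configuration, interface) is
shown to satisfy `𝟙[curve bit] = 𝟙[configuration event]` almost surely, one bit at a time.

* `frontier_symmDiff_subset` — `∂(s ∆ t) ⊆ ∂s ∪ ∂t`.
* `bit_passage` — **abstract limit passage of ONE bit** (portmanteau on the product space): if
  `(Xₙ, Yₙ) → λ` in law, the configuration event `A` and the curve event `B` are continuity sets
  of the two marginals of `λ`, the discrete curve bit `{Yₙ ∈ B}` is EVENTUALLY EXACTLY a lattice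
  event `Lₙ` (an exact dictionary) and `P(Lₙ ∆ {Xₙ ∈ A}) → 0` (a sandwich), then `λ`-a.s.
  `p.2 ∈ B ↔ p.1 ∈ A`.  Proof: `Δ = fst⁻¹ A ∆ snd⁻¹ B` has `λ`-null frontier, and the open-set
  portmanteau inequality (`measure_le_liminf_measure_preimage_of_isOpen`) bounds `λ (int Δ)` by
  `liminf P((Xₙ, Yₙ) ∈ Δ) = 0`.
* `tendsto_symmDiff_of_quadSandwich` — **the quad sandwich**: for a quad `Q` of `ℋ_ℂ` with
  `μ (∂⊞_Q) = 0`, strict two-sided perturbations `Qm t < Q < Qp t` converging to `Q` as `t → 0⁺`,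
  laws of `Xₙ` converging to `μ`, and lattice events with, eventually in `n`,
  `Lₙ ⊆ {Xₙ ∈ ⊞_{Qm t}}` and `{Xₙ ∈ ⊞_{Qp t}} ⊆ Lₙ ∪ Cₙ t` where `P(Cₙ t) ≤ g t → 0`, one gets
  `P(Lₙ ∆ {Xₙ ∈ ⊞_Q}) → 0`.  Proof: the discrepancy lies in `{Xₙ ∈ ⊞_{Qm t} ∖ int ⊞_{Qp t}} ∪ Cₙ t`;
  the closed-set portmanteau inequality bounds the limsup of the first probability by
  `μ (⊞_{Qm t} ∖ int ⊞_{Qp t})`, which tends to `μ (∂⊞_Q) = 0` as `t → 0⁺` because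
  `int ⊞_Q = ⋃_{Q' > Q} ⊞_{Q'}` (`QuadConfig.interior_crossedEvent_eq`).
* `measurableSet_stopAt_target_im_le`, `measurableSet_compl_hitsBefore` — the two kinds of
  class-level tournament bits (LOCATION bit "the first-contact point with the closed half-plane
  `{x₀ ≤ re}` has ordinate `≤ m`", ORDER bit "`F` is first hit no later than `F'`") are Borel
  events of `CurveClass ℂ`.
* `stub_quadTransfer_bitPassage`, `stub_quadTransfer_quadSandwich` — the registered one-line
  forms.

References: O. Schramm, S. Smirnov, *On the scaling limits of planar percolation*, Ann. Probab.
39 (2011), Lemma 5.1 and Cor. 5.2 (crossing events of quads are continuity sets; the sandwich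
between perturbed quads); N. Holden, X. Sun, *Convergence of uniform triangulations under the
Cardy embedding*, arXiv:1905.13207, Prop. 6.25, step (2) (identification of interface bits with
crossing events under a joint subsequential limit); P. Billingsley, *Convergence of probability
measures*, 2nd ed. (1999), Thm. 2.1 (portmanteau).
-/

noncomputable section

open MeasureTheory Filter Set Topology Metric
open scoped BoundedContinuousFunction ENNReal symmDiff
open Literature.Probability.Percolation
open Literature.Probability.RandomPlanarGeometry Literature.Probability.Percolation.QuadCrossing

namespace Summit.CriticalPhenomena.CardyFormulaZ2.Cruxes.LagHandOff.HittingTournament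

/-! ### Frontier of a symmetric difference -/

/-- **The frontier of a symmetric difference** is contained in the union of the frontiers:
`∂(s ∆ t) ⊆ ∂s ∪ ∂t` (from `∂(s ∪ t)`, `∂(s ∩ t) ⊆ ∂s ∪ ∂t` and `∂(tᶜ) = ∂t`). -/
theorem frontier_symmDiff_subset {α : Type*} [TopologicalSpace α] (s t : Set α) :
    frontier (s ∆ t) ⊆ frontier s ∪ frontier t := by
  have hdiff : ∀ s t : Set α, frontier (s \ t) ⊆ frontier s ∪ frontier t := by
    intro s t x hx
    rw [Set.sdiff_eq] at hx
    rcases frontier_inter_subset s tᶜ hx with ⟨h, -⟩ | ⟨-, h⟩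
    · exact Or.inl h
    · rw [frontier_compl] at h
      exact Or.inr h
  rw [Set.symmDiff_def]
  intro x hx
  rcases frontier_union_subset _ _ hx with ⟨h, -⟩ | ⟨-, h⟩
  · exact hdiff s t h
  · rcases hdiff t s h with h' | h'
    · exact Or.inr h'
    · exact Or.inl h'

/-! ### The abstract passage of one bit to a joint limit -/

section BitPassage

variable {Ω : Type*} [MeasurableSpace Ω]

/-- **Abstract limit passage of ONE bit** (portmanteau on the product space
`ℋ_ℂ × CurveClass ℂ`).  If `(Xₙ, Yₙ) → λ` in law (tested on bounded continuous functions), the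
configuration event `A` and the curve event `B` are continuity sets of the marginals of `λ`, the
discrete curve bit is EVENTUALLY EXACTLY a lattice event `Lₙ` (`Yₙ ω ∈ B ↔ ω ∈ Lₙ`, an exact
dictionary), and `Lₙ` differs from `{Xₙ ∈ A}` by `o(1)` in probability (a quad sandwich), then
`λ`-almost surely `p.2 ∈ B ↔ p.1 ∈ A`.  (The measurability hypotheses on `A`, `B`, `Lₙ` are not
used by the proof; they are kept for the callers' bookkeeping.) -/
theorem bit_passage (P : Measure Ω) [IsProbabilityMeasure P]
    (X : ℕ → Ω → QuadConfig (univ : Set ℂ)) (Y : ℕ → Ω → CurveClass ℂ)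
    (hX : ∀ n, Measurable (X n)) (hY : ∀ n, Measurable (Y n))
    (lam : Measure (QuadConfig (univ : Set ℂ) × CurveClass ℂ)) [IsProbabilityMeasure lam]
    (hconv : ∀ f : (QuadConfig (univ : Set ℂ) × CurveClass ℂ) →ᵇ ℝ,
      Tendsto (fun n => ∫ ω, f (X n ω, Y n ω) ∂P) atTop (𝓝 (∫ p, f p ∂lam)))
    (A : Set (QuadConfig (univ : Set ℂ))) (_hAm : MeasurableSet A)
    (hAfr : lam.map Prod.fst (frontier A) = 0)
    (B : Set (CurveClass ℂ)) (_hBm : MeasurableSet B) (hBfr : lam.map Prod.snd (frontier B) = 0)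
    (L : ℕ → Set Ω) (_hLm : ∀ n, MeasurableSet (L n))
    (hdict : ∀ᶠ n in atTop, ∀ ω, (Y n ω ∈ B ↔ ω ∈ L n))
    (hLA : Tendsto (fun n => P ((L n) ∆ (X n ⁻¹' A))) atTop (𝓝 0)) :
    ∀ᵐ p ∂lam, (p.2 ∈ B ↔ p.1 ∈ A) := by
  -- topology / measurability bookkeeping on `ℋ_ℂ × CurveClass ℂ`
  haveI : T2Space (QuadConfig (univ : Set ℂ)) :=
    (SchrammSmirnov2011_thm_1_4_holds univ isOpen_univ univ_nonempty).1.2.2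
  haveI : TopologicalSpace.MetrizableSpace (QuadConfig (univ : Set ℂ)) :=
    (SchrammSmirnov2011_thm_1_4_holds univ isOpen_univ univ_nonempty).1.2.1
  letI : MetricSpace (QuadConfig (univ : Set ℂ)) := TopologicalSpace.metrizableSpaceMetric _
  haveI : CompactSpace (QuadConfig (univ : Set ℂ)) := QuadConfig.compactSpace
  haveI : SecondCountableTopology (QuadConfig (univ : Set ℂ)) :=
    EMetric.secondCountable_of_sigmaCompact _
  haveI : BorelSpace (QuadConfig (univ : Set ℂ) × CurveClass ℂ) := Prod.borelSpace
  set Z : ℕ → Ω → QuadConfig (univ : Set ℂ) × CurveClass ℂ := fun n ω => (X n ω, Y n ω) with hZ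
  have hZm : ∀ n, Measurable (Z n) := fun n => (hX n).prodMk (hY n)
  set Δ : Set (QuadConfig (univ : Set ℂ) × CurveClass ℂ) :=
    (Prod.fst ⁻¹' A) ∆ (Prod.snd ⁻¹' B) with hΔ
  -- the frontier of `Δ` is `λ`-null
  have hfr : lam (frontier Δ) = 0 := by
    have hsub : frontier Δ ⊆ Prod.fst ⁻¹' frontier A ∪ Prod.snd ⁻¹' frontier B :=
      (frontier_symmDiff_subset _ _).trans (union_subset_union
        (continuous_fst.frontier_preimage_subset A) (continuous_snd.frontier_preimage_subset B))
    have h1 : lam (Prod.fst ⁻¹' frontier A) = 0 := by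
      rw [← Measure.map_apply measurable_fst isClosed_frontier.measurableSet]; exact hAfr
    have h2 : lam (Prod.snd ⁻¹' frontier B) = 0 := by
      rw [← Measure.map_apply measurable_snd isClosed_frontier.measurableSet]; exact hBfr
    exact measure_mono_null hsub (measure_union_null h1 h2)
  -- the discrete probabilities of `Δ` tend to `0` (dictionary + sandwich)
  have hPΔ : Tendsto (fun n => P (Z n ⁻¹' Δ)) atTop (𝓝 0) := by
    refine hLA.congr' ?_
    filter_upwards [hdict] with n hn
    have hYB : Y n ⁻¹' B = L n := Set.ext fun ω => hn ω
    show P ((L n) ∆ (X n ⁻¹' A)) = P (Z n ⁻¹' ((Prod.fst ⁻¹' A) ∆ (Prod.snd ⁻¹' B)))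
    rw [Set.preimage_symmDiff, symmDiff_comm, ← hYB]
    rfl
  -- portmanteau on the open interior
  have hint : lam (interior Δ) ≤ atTop.liminf fun n => P (Z n ⁻¹' interior Δ) :=
    measure_le_liminf_measure_preimage_of_isOpen hZm hconv isOpen_interior
  have hlim0 : (atTop.liminf fun n => P (Z n ⁻¹' interior Δ)) ≤ 0 := by
    calc (atTop.liminf fun n => P (Z n ⁻¹' interior Δ))
        ≤ atTop.liminf fun n => P (Z n ⁻¹' Δ) :=
          liminf_le_liminf (Eventually.of_forall fun n =>
            measure_mono (preimage_mono interior_subset))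
      _ = 0 := hPΔ.liminf_eq
  have hΔ0 : lam Δ = 0 := by
    refine le_antisymm ?_ bot_le
    calc lam Δ ≤ lam (interior Δ ∪ frontier Δ) := by
          refine measure_mono ?_
          rw [← closure_eq_interior_union_frontier]
          exact subset_closure
      _ ≤ lam (interior Δ) + lam (frontier Δ) := measure_union_le _ _
      _ ≤ 0 := by rw [hfr, add_zero]; exact hint.trans hlim0
  rw [measure_eq_zero_iff_ae_notMem] at hΔ0
  filter_upwards [hΔ0] with p hp
  simp only [hΔ, Set.mem_symmDiff, mem_preimage] at hp
  tauto

/-! ### The quad sandwich -/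

open QuadConfig in
/-- **Quad sandwich ⇒ the lattice event is `o(1)`-close to `{Xₙ ∈ ⊞_Q}`** (Schramm–Smirnov 2011,
mechanism of Lemma 5.1 / Cor. 5.2).  `Qm t < Q < Qp t` are two-sided strict perturbations
converging to `Q` as `t → 0⁺` (they exist for every quad, `Quad.exists_perturbations`);
eventually `Lₙ ⊆ {Xₙ ∈ ⊞_{Qm t}}` (a lattice witness IS a crossing of the easier quad) and
`{Xₙ ∈ ⊞_{Qp t}} ⊆ Lₙ ∪ Cₙ t` (a crossing of the harder quad gives a lattice witness unless a
corner event `Cₙ t` of probability `≤ g t → 0` occurs); the laws of `Xₙ` converge to `μ` with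
`μ (∂⊞_Q) = 0`.  Then `P(Lₙ ∆ {Xₙ ∈ ⊞_Q}) → 0`.  (The measurability of `Lₙ` is not used by the
proof; it is kept for the callers' bookkeeping.) -/
theorem tendsto_symmDiff_of_quadSandwich (P : Measure Ω) [IsProbabilityMeasure P]
    (X : ℕ → Ω → QuadConfig (univ : Set ℂ)) (hX : ∀ n, Measurable (X n))
    (μ : Measure (QuadConfig (univ : Set ℂ))) [IsProbabilityMeasure μ]
    (hconv : ∀ f : QuadConfig (univ : Set ℂ) →ᵇ ℝ,
      Tendsto (fun n => ∫ ω, f (X n ω) ∂P) atTop (𝓝 (∫ S, f S ∂μ)))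
    (Q : Quad (univ : Set ℂ)) (hQ : μ (frontier (QuadConfig.crossedEvent Q)) = 0)
    (Qm Qp : ℝ → Quad (univ : Set ℂ))
    (hm : ∀ t, 0 < t → Quad.StrictlyDominated (Qm t) Q)
    (hp : ∀ t, 0 < t → Quad.StrictlyDominated Q (Qp t))
    (hmlim : Tendsto Qm (𝓝[>] 0) (𝓝 Q)) (hplim : Tendsto Qp (𝓝[>] 0) (𝓝 Q))
    (L : ℕ → Set Ω) (_hLm : ∀ n, MeasurableSet (L n)) (C : ℕ → ℝ → Set Ω) (g : ℝ → ℝ≥0∞)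
    (hg : Tendsto g (𝓝[>] 0) (𝓝 0))
    (hlow : ∀ t, 0 < t → ∀ᶠ n in atTop, L n ⊆ X n ⁻¹' QuadConfig.crossedEvent (Qm t))
    (hupp : ∀ t, 0 < t → ∀ᶠ n in atTop, X n ⁻¹' QuadConfig.crossedEvent (Qp t) ⊆ L n ∪ C n t)
    (hC : ∀ t, 0 < t → ∀ᶠ n in atTop, P (C n t) ≤ g t) :
    Tendsto (fun n => P ((L n) ∆ (X n ⁻¹' QuadConfig.crossedEvent Q))) atTop (𝓝 0) := by
  -- instances on `ℋ_ℂ`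
  haveI : T2Space (QuadConfig (univ : Set ℂ)) :=
    (SchrammSmirnov2011_thm_1_4_holds univ isOpen_univ univ_nonempty).1.2.2
  haveI : TopologicalSpace.MetrizableSpace (QuadConfig (univ : Set ℂ)) :=
    (SchrammSmirnov2011_thm_1_4_holds univ isOpen_univ univ_nonempty).1.2.1
  letI : MetricSpace (QuadConfig (univ : Set ℂ)) := TopologicalSpace.metrizableSpaceMetric _
  -- the closed sets `F t = ⊞_{Qm t} ∖ int ⊞_{Qp t}`
  set F : ℝ → Set (QuadConfig (univ : Set ℂ)) := fun t =>
    crossedEvent (Qm t) \ interior (crossedEvent (Qp t)) with hF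
  have hFcl : ∀ t, IsClosed (F t) := fun t => (isClosed_crossedEvent _).sdiff isOpen_interior
  have hFm : ∀ t, MeasurableSet (F t) := fun t => (hFcl t).measurableSet
  -- (1) `μ (F t) → μ (∂⊞_Q) = 0` as `t → 0⁺` (pointwise eventual equality of memberships)
  have h1 : Tendsto (fun t => μ (F t)) (𝓝[>] 0) (𝓝 0) := by
    have key := tendsto_measure_of_tendsto_indicator_of_isFiniteMeasure (𝓝[>] (0 : ℝ)) μ hFm
      (A := frontier (crossedEvent Q)) ?_
    · rwa [hQ] at key
    intro S
    by_cases hSQ : S ∈ crossedEvent Q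
    · by_cases hSint : S ∈ interior (crossedEvent Q)
      · have hnotfr : S ∉ frontier (crossedEvent Q) := fun h => h.2 hSint
        rw [interior_crossedEvent_eq] at hSint
        obtain ⟨Q', hQ', hS'⟩ := mem_iUnion₂.1 hSint
        have hev : ∀ᶠ t in 𝓝[>] (0 : ℝ), Quad.StrictlyDominated (Qp t) Q' :=
          hplim.eventually ((Quad.isOpen_setOf_strictlyDominated_left Q').mem_nhds hQ')
        filter_upwards [hev] with t ht
        exact ⟨fun hFt => absurd (mem_interior_crossedEvent_of_mem ht hS') hFt.2,
          fun hfr => absurd hfr hnotfr⟩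
      · have hfr : S ∈ frontier (crossedEvent Q) := by
          rw [(isClosed_crossedEvent Q).frontier_eq]; exact ⟨hSQ, hSint⟩
        filter_upwards [self_mem_nhdsWithin] with t ht
        exact ⟨fun _ => hfr, fun _ => ⟨crossedEvent_subset_of_strictlyDominated (hm t ht) hSQ,
          fun h => hSint (interior_mono (crossedEvent_subset_of_strictlyDominated (hp t ht)) h)⟩⟩
    · have hnotfr : S ∉ frontier (crossedEvent Q) :=
        fun h => hSQ ((isClosed_crossedEvent Q).frontier_subset h)
      have hQS : Q ∉ (S : Set (Quad (univ : Set ℂ))) := hSQ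
      have hopen : IsOpen ((S : Set (Quad (univ : Set ℂ)))ᶜ) := S.2.1.isOpen_compl
      have hev : ∀ᶠ t in 𝓝[>] (0 : ℝ), Qm t ∈ (S : Set (Quad (univ : Set ℂ)))ᶜ :=
        hmlim.eventually (hopen.mem_nhds hQS)
      filter_upwards [hev] with t ht
      exact ⟨fun hFt => absurd hFt.1 ht, fun h => absurd h hnotfr⟩
  -- (2) eventually `P(Lₙ ∆ {Xₙ ∈ ⊞_Q}) ≤ P(Xₙ ∈ F t) + g t`
  have h2 : ∀ t, 0 < t → ∀ᶠ n in atTop,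
      P ((L n) ∆ (X n ⁻¹' crossedEvent Q)) ≤ P (X n ⁻¹' F t) + g t := by
    intro t ht
    filter_upwards [hlow t ht, hupp t ht, hC t ht] with n hl hu hc
    have hsub : (L n) ∆ (X n ⁻¹' crossedEvent Q) ⊆ X n ⁻¹' F t ∪ C n t := by
      intro ω hω
      rw [Set.mem_symmDiff] at hω
      rcases hω with ⟨hL, hnQ⟩ | ⟨hQω, hnL⟩
      · exact Or.inl ⟨hl hL, fun h => hnQ
          (crossedEvent_subset_of_strictlyDominated (hp t ht) (interior_subset h))⟩
      · by_cases hint : X n ω ∈ interior (crossedEvent (Qp t))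
        · have hmem' : X n ω ∈ crossedEvent (Qp t) := interior_subset hint
          have hmem : ω ∈ X n ⁻¹' crossedEvent (Qp t) := hmem'
          rcases hu hmem with h | h
          · exact absurd h hnL
          · exact Or.inr h
        · exact Or.inl ⟨crossedEvent_subset_of_strictlyDominated (hm t ht) hQω, hint⟩
    calc P ((L n) ∆ (X n ⁻¹' crossedEvent Q)) ≤ P (X n ⁻¹' F t ∪ C n t) := measure_mono hsub
      _ ≤ P (X n ⁻¹' F t) + P (C n t) := measure_union_le _ _
      _ ≤ P (X n ⁻¹' F t) + g t := add_le_add le_rfl hc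
  -- (3) portmanteau, closed sets: `limsupₙ P(Xₙ ∈ F t) ≤ μ (F t)`
  have h3 : ∀ t, atTop.limsup (fun n => P (X n ⁻¹' F t)) ≤ μ (F t) := by
    intro t
    set μs : ℕ → ProbabilityMeasure (QuadConfig (univ : Set ℂ)) := fun n =>
      ⟨P.map (X n), Measure.isProbabilityMeasure_map (hX n).aemeasurable⟩ with hμs
    set μ' : ProbabilityMeasure (QuadConfig (univ : Set ℂ)) := ⟨μ, inferInstance⟩ with hμ'
    have htend : Tendsto μs atTop (𝓝 μ') := by
      rw [ProbabilityMeasure.tendsto_iff_forall_integral_tendsto]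
      intro f
      have e1 : ∀ n, ∫ y, f y ∂(μs n : Measure (QuadConfig (univ : Set ℂ))) =
          ∫ ω, f (X n ω) ∂P := fun n => by
        show ∫ y, f y ∂(P.map (X n)) = ∫ ω, f (X n ω) ∂P
        exact integral_map (hX n).aemeasurable f.continuous.aestronglyMeasurable
      have e1' : ∫ y, f y ∂(μ' : Measure (QuadConfig (univ : Set ℂ))) = ∫ S, f S ∂μ := rfl
      rw [e1']
      exact (hconv f).congr fun n => (e1 n).symm
    have hlim := ProbabilityMeasure.limsup_measure_closed_le_of_tendsto htend (hFcl t)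
    have e2 : ∀ n, ((μs n : ProbabilityMeasure (QuadConfig (univ : Set ℂ))) :
        Measure (QuadConfig (univ : Set ℂ))) (F t) = P (X n ⁻¹' F t) := fun n => by
      show (P.map (X n)) (F t) = P (X n ⁻¹' F t)
      exact Measure.map_apply (hX n) (hFm t)
    simp_rw [e2] at hlim
    exact hlim
  -- (4) conclusion: `∀ ε > 0`, eventually `≤ ε`
  rw [ENNReal.tendsto_nhds_zero]
  intro ε hε
  have hε2 : 0 < ε / 2 := ENNReal.half_pos hε.ne'
  have hev : ∀ᶠ t in 𝓝[>] (0 : ℝ), μ (F t) < ε / 2 ∧ g t < ε / 2 ∧ 0 < t := by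
    filter_upwards [h1.eventually (gt_mem_nhds hε2), hg.eventually (gt_mem_nhds hε2),
      self_mem_nhdsWithin] with t h h' h''
    exact ⟨h, h', h''⟩
  obtain ⟨t, hμt, hgt, ht⟩ := hev.exists
  have h4 : ∀ᶠ n in atTop, P (X n ⁻¹' F t) < ε / 2 :=
    eventually_lt_of_limsup_lt ((h3 t).trans_lt hμt)
  filter_upwards [h2 t ht, h4] with n hn hn'
  calc P ((L n) ∆ (X n ⁻¹' crossedEvent Q)) ≤ P (X n ⁻¹' F t) + g t := hn
    _ ≤ ε / 2 + ε / 2 := add_le_add hn'.le hgt.le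
    _ = ε := ENNReal.add_halves ε

end BitPassage

/-! ### The tournament bits are Borel events of `CurveClass ℂ` -/

/-- **The LOCATION bit is a Borel event.**  For the closed half-plane `{x₀ ≤ re}` and a threshold
height `m`, the class event "the first-contact point (the target of the stopped class
`CurveClass.stopAt {x₀ ≤ re} γ`) has ordinate `≤ m`" is measurable
(`CurveClass.measurable_stopAt` and continuity of `target`). -/
theorem measurableSet_stopAt_target_im_le (x₀ m : ℝ) :
    MeasurableSet {γ : CurveClass ℂ | (CurveClass.stopAt {z : ℂ | x₀ ≤ z.re} γ).target.im ≤ m} := by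
  have hF : IsClosed {z : ℂ | x₀ ≤ z.re} := isClosed_le continuous_const Complex.continuous_re
  have h1 : Measurable fun γ : CurveClass ℂ =>
      (CurveClass.stopAt {z : ℂ | x₀ ≤ z.re} γ).target :=
    CurveClass.continuous_target.measurable.comp (CurveClass.measurable_stopAt hF)
  exact measurableSet_le (Complex.continuous_im.measurable.comp h1) measurable_const

/-- **The ORDER bit is a Borel event.**  For closed `F`, `F'` the class event "`F` is first hit
no later than `F'`", i.e. the complement of `CurveClass.hitsBefore F' F`, is measurable
(`CurveClass.measurableSet_hitsBefore_holds`). -/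
theorem measurableSet_compl_hitsBefore {F F' : Set ℂ} (hF : IsClosed F) (hF' : IsClosed F') :
    MeasurableSet (CurveClass.hitsBefore F' F)ᶜ :=
  (CurveClass.measurableSet_hitsBefore_holds hF' hF).compl

/-! ### Registered forms -/

/-- **Registered stub `stub_quadTransfer_bitPassage`** (line `hitting-tournament`, R1 method
step (d)): `bit_passage` with all binders explicit. -/
theorem stub_quadTransfer_bitPassage : ∀ {Ω : Type*} [MeasurableSpace Ω] (P : Measure Ω) [IsProbabilityMeasure P] (X : ℕ → Ω → QuadConfig (Set.univ : Set ℂ)) (Y : ℕ → Ω → CurveClass ℂ), (∀ n, Measurable (X n)) → (∀ n, Measurable (Y n)) → ∀ (lam : Measure (QuadConfig (Set.univ : Set ℂ) × CurveClass ℂ)) [IsProbabilityMeasure lam], (∀ f : (QuadConfig (Set.univ : Set ℂ) × CurveClass ℂ) →ᵇ ℝ, Tendsto (fun n => ∫ ω, f (X n ω, Y n ω) ∂P) atTop (𝓝 (∫ p, f p ∂lam))) → ∀ (A : Set (QuadConfig (Set.univ : Set ℂ))), MeasurableSet A → lam.map Prod.fst (frontier A) = 0 → ∀ (B : Set (CurveClass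 ℂ)), MeasurableSet B → lam.map Prod.snd (frontier B) = 0 → ∀ (L : ℕ → Set Ω), (∀ n, MeasurableSet (L n)) → (∀ᶠ n in atTop, ∀ ω, (Y n ω ∈ B ↔ ω ∈ L n)) → Tendsto (fun n => P (symmDiff (L n) (X n ⁻¹' A))) atTop (𝓝 0) → ∀ᵐ p ∂lam, (p.2 ∈ B ↔ p.1 ∈ A) :=
  @bit_passage

/-- **Registered stub `stub_quadTransfer_quadSandwich`** (line `hitting-tournament`, R1 method
step (d)): `tendsto_symmDiff_of_quadSandwich` with all binders explicit. -/
theorem stub_quadTransfer_quadSandwich : ∀ {Ω : Type*} [MeasurableSpace Ω] (P : Measure Ω) [IsProbabilityMeasure P] (X : ℕ → Ω → QuadConfig (Set.univ : Set ℂ)), (∀ n, Measurable (X n)) → ∀ (μ : Measure (QuadConfig (Set.univ : Set ℂ))) [IsProbabilityMeasure μ], (∀ f : QuadConfig (Set.univ : Set ℂ) →ᵇ ℝ, Tendsto (fun n => ∫ ω, f (X n ω) ∂P) atTop (𝓝 (∫ S, f S ∂μ))) → ∀ (Q : Quad (Set.univ : Set ℂ)), μ (frontier (QuadConfig.crossedEvent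 Q)) = 0 → ∀ (Qm Qp : ℝ → Quad (Set.univ : Set ℂ)), (∀ t, 0 < t → Quad.StrictlyDominated (Qm t) Q) → (∀ t, 0 < t → Quad.StrictlyDominated Q (Qp t)) → Tendsto Qm (nhdsWithin (0 : ℝ) (Set.Ioi 0)) (𝓝 Q) → Tendsto Qp (nhdsWithin (0 : ℝ) (Set.Ioi 0)) (𝓝 Q) → ∀ (L : ℕ → Set Ω), (∀ n, MeasurableSet (L n)) → ∀ (C : ℕ → ℝ → Set Ω) (g : ℝ → ENNReal), Tendsto g (nhdsWithin (0 : ℝ) (Set.Ioi 0)) (𝓝 0) → (∀ t, 0 < t → ∀ᶠ n in atTop, L n ⊆ X n ⁻¹' QuadConfig.crossedEvent (Qm t)) → (∀ t, 0 < t → ∀ᶠ n in atTop, X n ⁻¹' QuadConfig.crossedEvent (Qp t) ⊆ L n ∪ C n t) → (∀ t, 0 < t → ∀ᶠ n in atTop, P (C n t) ≤ g t) → Tendsto (fun n => P (symmDiff (L n) (X n ⁻¹' QuadConfig.crossedEvent Q))) atTop (𝓝 0) :=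
  @tendsto_symmDiff_of_quadSandwich

end Summit.CriticalPhenomena.CardyFormulaZ2.Cruxes.LagHandOff.HittingTournament

end
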